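import Summits.BirchSwinnertonDyer.BirchSwinnertonDyer.Theorems.SignedLowerHalvesKobayashiLowerHalfLargeImageKuriharaRigidityFouquetWanKatoFrame
import Literature.NumberTheory.EllipticCurves.FouquetWan2021.KatoMainIdentityOPEN
import HarnessLib

/-!
# The Fouquet–Wan road of crux `KobayashiLowerHalfLargeImage` FROM NAMED FACTS BY NAME: the composite binder
# `FouquetWan2021_thm51_via_kobayashi74_OPEN` ⟸ {`FouquetWan2021.thm51_katoMainIdentity_OPEN` (PREPRINT claim on
# the `η = 1` package), Kobayashi Thm. 1.2, the two period facts}, Kobayashi 7.4 IN THE KERNEL; and the crux's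
# conclusion on the FW locus of X7 restated on those finer inputs (route `SignedLowerHalves`, item
# stmt-BirchSwinnertonDyer-19001; cell `bsd-ssimc`, seat `bsd-line-slh-p1-w2` g2; `--supports … --as helper`)

The sibling `…KuriharaRigidityFouquetWanKatoFrame` (p613135) derives the accepted composite binder
`FouquetWan2021_thm51_via_kobayashi74_OPEN` («FW Thm 5.1 (PRE) ∘ Kobayashi 7.4 (PUB)», the FW-locus road of crux 3:
`X7.kobayashiLowerDivisibility_of_thm51_OPEN`, `…FWLocusAllRanks`, the birth skeleton's `stub_fwLocus`, the lead's
FW-locus reading of `stub_three`) from a DISPLAYED frame — the body of the Literature statement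
`FouquetWan2021.thm51_katoMainIdentity_OPEN`, then in flight. That statement has LANDED (p612468); this file restates
the derivation with the fact BY NAME (§1, definitional unfolding only) and re-keys the road's main consumer on the
finer inputs (§2): crux 3's conclusion `∃ ε, KobayashiLowerDivisibility W p ε` at every X7 pair with `p ≠ 2`,
`a_p = 0` and a ramified non-split Steinberg prime, CONDITIONAL on {FW Thm. 5.1 read on the package [PREPRINT claim,
never a theorem], Kobayashi Thm. 1.2, the period facts at `p ≥ 5` and `p = 3` [PUBLISHED]} — the ± step being the
kernel's (lead g2's `…Thm74Odd`, p612293). TRUST BASE of the FW road after this file (numbers, not adjectives): 1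
PREPRINT claim stated on Kato's objects + 3 PUBLISHED named facts; 0 composite binders; Kobayashi 7.4 nowhere on
faith. HONEST FRAMING (cell `bsd-ssimc`, D-0036/D-0074): TOOL THEOREMS ONLY, no definition, no named fact minted, no
`sorry`, axioms standard; the class-wide crux, the preprint status of FW Thm. 5.1 (flags `FW21-51-eta1-zeta-line`,
`FW21-51-package`, `A-KATO-3`, `FW21-Wan15`) and the route are NOT closed or changed; nothing is booked; BSD is not
proved by any of this. `--supports stmt-BirchSwinnertonDyer-19001 --as helper`.

References: [FouquetWan2021] Conj. 1.5, Thm. 5.1 (p. 53); [Kobayashi2003] Thm. 1.2 (p. 2), Thm. 7.4 (p. 13);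
[GreenbergVatsal2000] §3 Rem. 3.4; [Mazur1978] Cor. 4.1; [Serre1972] Prop. 12.
-/

set_option autoImplicit false
-- single-problem summit (D-0017): the doubled namespace component is by design
set_option linter.dupNamespace false

noncomputable section

open scoped Classical MatrixGroups ModularForm

open CongruenceSubgroup Field WeierstrassCurve Literature.NumberTheory.EllipticCurves
  Literature.NumberTheory.EllipticCurves.ModularForms Literature.NumberTheory.GaloisRepresentations
  Literature.NumberTheory.EllipticCurves.Rank1Residual Summit.BirchSwinnertonDyer.Rank1Residual.Supersingular

namespace Summit.BirchSwinnertonDyer.BirchSwinnertonDyer.Theorems.KuriharaRigidity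

/-! ## §1 The composite binder from named facts BY NAME -/

/-- **`FouquetWan2021_thm51_via_kobayashi74_OPEN` from NAMED inputs**: Fouquet–Wan Thm. 5.1 read on the `η = 1`
package (`hFW : FouquetWan2021.thm51_katoMainIdentity_OPEN`, [claim under-review] — never a theorem), Kobayashi
Thm. 1.2 (`h12`), the period facts (`h5`, `h3`) — by `fouquetWan2021_thm51_via_kobayashi74_OPEN_of_katoFrame`
(Kobayashi Thm. 7.4 (ii) in the kernel at every odd `p`). CONDITIONAL; closes nothing.
[claim: FouquetWan2021, status: under-review] [cite: Kobayashi2003, Thm. 7.4 (p. 13), Thm. 1.2 (p. 2)]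
[cite: GreenbergVatsal2000, §3, Remark 3.4] [cite: Mazur1978, Cor. 4.1] -/
theorem fouquetWan2021_thm51_via_kobayashi74_OPEN_of_facts
    (hFW : FouquetWan2021.thm51_katoMainIdentity_OPEN)
    (h12 : Kobayashi2003.thm12_signedSelmerDual_finite_torsion)
    (h5 : realPeriodRat_eq_unit_mul_plusPeriod) (h3 : realPeriodRat_eq_unit_mul_plusPeriod_three) :
    FouquetWan2021_thm51_via_kobayashi74_OPEN :=
  fouquetWan2021_thm51_via_kobayashi74_OPEN_of_katoFrame hFW h12 h5 h3

/-! ## §2 Crux 3 on the Fouquet–Wan locus of X7, on the finer inputs -/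

/-- **Crux `KobayashiLowerHalfLargeImage`'s conclusion on the FW locus of X7, EITHER rank, from the finer named
inputs**: at an X7 pair with `p ≠ 2`, `a_p = 0` (`E[p]` irreducible by Serre's Prop. 12 on X7, `ClassX7.irr`) and a
non-split multiplicative prime `ℓ ≠ p` with `p ∤ ord_ℓ(Δ_min)`, the Eisenstein half of Kobayashi's main conjecture
holds for some (indeed every) sign — the road's consumer `X7.kobayashiLowerDivisibility_of_thm51_OPEN` fed with §1.
GRANTED `hFW` (PREPRINT claim on Kato's objects), `h12`, `h5`, `h3` (PUBLISHED). CONDITIONAL; closes nothing; the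
stub's binders `¬CM`, `Surj` are not needed and omitted, as in the consumer. [claim: FouquetWan2021, status: under-review]
[cite: Kobayashi2003, Thm. 1.2 (p. 2), Thm. 7.4 (p. 13)] [cite: Serre1972, Prop. 12] -/
theorem X7.kobayashiLowerDivisibility_of_fw51_katoMainIdentity_OPEN
    (hFW : FouquetWan2021.thm51_katoMainIdentity_OPEN)
    (h12 : Kobayashi2003.thm12_signedSelmerDual_finite_torsion)
    (h5 : realPeriodRat_eq_unit_mul_plusPeriod) (h3 : realPeriodRat_eq_unit_mul_plusPeriod_three)
    (W : WeierstrassCurve ℚ) [W.IsElliptic] [W.IsGloballyMinimal] (p : ℕ) [Fact p.Prime]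
    (hp : p ≠ 2) (hX : ClassX7 W p) (hap : W.frobeniusTrace p = 0)
    (hloc : ∃ (ℓ : ℕ) (_ : Fact ℓ.Prime), ℓ ≠ p ∧ W.HasMultiplicativeReductionAtPrime ℓ ∧
        ¬ W.HasSplitMultiplicativeReductionAtPrime ℓ ∧ ¬ p ∣ padicValInt ℓ W.minimalDiscriminantInt) :
    ∃ ε : ℤˣ, KobayashiLowerDivisibility W p ε :=
  X7.kobayashiLowerDivisibility_of_thm51_OPEN W p (fouquetWan2021_thm51_via_kobayashi74_OPEN_of_facts hFW h12 h5 h3)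
    hp hX hap hloc

end Summit.BirchSwinnertonDyer.BirchSwinnertonDyer.Theorems.KuriharaRigidity

end
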